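import Summits.Ventures.Crystal3D.Theorems.StickyWulffConstantGenericWallFloorMultiStarCount
import Summits.Ventures.Crystal3D.Theorems.StickyWulffConstantGenericWallFloorStackWalkInjective
import HarnessLib

/-!
# Tools for the localised stack ledger: full twin-dozen certificates, the cap-pair input, bottoms of stacks,
# and the cross-grain non-co-axiality for non-chain pairs (crux `GenericWallFloor`, line `WallLedgerG`)

HONEST FRAMING. Part of the venture `Summits/Ventures/Crystal3D` (cell `crystal3d-full`), helper
`--supports` the crux `GenericWallFloor` (stmt-Ventures-19480) of `route-Ventures-StickyWulffConstant`,
registered line `WallLedgerG`, open stub `stub_twoSlabAdhesion` (general fillings).  Bricks for the residual-free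
non-chain stack ledger (next file):

* `CapCertified`, `WalkCertified12` — the walker certificate with the FULL twelve-ball twin dozen of an exact-cap
  predecessor (the landed `WalkCertified` records nine of its balls); `walkStep_certified12` (every state reached
  by a step carries it).
* `CapPairCoaxial` — THE NEW NAMED INPUT (R39e, to be certified like R39d): a ball carrying two walker
  certificates at least one of which is of cap type, and an eleventh contact off the two closed stars, has
  CO-AXIAL top lattices.  With `DoubleStarCoaxialAt` (R39d, certified: `doubleStarCoaxialAt_of_far`) for the
  full/full case this prices every pair of coincident walk ends (`coaxial_of_pair_certified`).
* `walkStep_getLast?`, `walkRun_getLast?` — the bottom entry of a stack never changes.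
* `eq_or_twin_of_coaxial` — co-axial linear fcc lattices are equal or mirror twins across a menu normal.
* `family_twin`, `family_of_stack`, **`not_coaxial_of_family_stack`** — for a mirror-closed family `𝓕₁` avoiding
  the lattice of `A₂` (19480-p1's non-chain hypothesis), no lattice of `𝓕₁` is co-axial with the top lattice of a
  sound stack over `A₂` (descend the stack inside `𝓕₁`).

WHAT THIS IS NOT: not the stub; `CapPairCoaxial` is an INPUT (uncertified as of this file); F-C1 not moved.
-/

noncomputable section

namespace Summit.Ventures.Crystal3D.Theorems

open Finset
open Literature.MathematicalPhysics.StatisticalMechanics (fccStacking barlowStacking IsHaggSeq)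
open scoped InnerProductSpace

variable {X : Finset (EuclideanSpace ℝ (Fin 3))}

/-! ### Certificates with the full twin dozen -/

/-- The CAP certificate of a walker at `e` with entry `(F, v)` and cap normal `n₀`: the predecessor `e − F v` is
an exact cap seen from the capper side `F` — unit menu normal `n₀` with `⟪F v, n₀⟫ > 0`, the nine
`n₀`-non-negative `F`-slots of the predecessor occupied AND the three lowered positive slots
`e − F v + F w − 2√(2/3) n₀` (`⟪F w, n₀⟫ > 0`) occupied: the predecessor's full twelve-ball twin dozen. -/
def CapCertified (X : Finset (EuclideanSpace ℝ (Fin 3))) (F : EuclideanSpace ℝ (Fin 3) ≃ₗᵢ[ℝ] EuclideanSpace ℝ (Fin 3))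
    (e v n₀ : EuclideanSpace ℝ (Fin 3)) : Prop :=
  ‖n₀‖ = 1 ∧
  (∀ w ∈ fccSlots, ⟪F w, n₀⟫_ℝ = 0 ∨ ⟪F w, n₀⟫_ℝ = Real.sqrt (2 / 3) ∨ ⟪F w, n₀⟫_ℝ = -Real.sqrt (2 / 3)) ∧
  0 < ⟪F v, n₀⟫_ℝ ∧ e - F v ∈ X ∧
  (∀ w ∈ fccSlots, 0 ≤ ⟪F w, n₀⟫_ℝ → e - F v + F w ∈ X) ∧
  (∀ w ∈ fccSlots, 0 < ⟪F w, n₀⟫_ℝ → e - F v + F w - (2 * Real.sqrt (2 / 3)) • n₀ ∈ X)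

/-- `WalkCertified` with the full twin dozen in the cap case. -/
def WalkCertified12 (X : Finset (EuclideanSpace ℝ (Fin 3))) (y : EuclideanSpace ℝ (Fin 3)) (e : WalkEntry) : Prop :=
  (y - e.frame e.dir ∈ X ∧ ∀ w ∈ fccSlots, y - e.frame e.dir + e.frame w ∈ X) ∨
  ∃ n₀, CapCertified X e.frame y e.dir n₀

/-- The strong certificate implies the landed one. -/
theorem WalkCertified12.walkCertified {y : EuclideanSpace ℝ (Fin 3)} {e : WalkEntry} (h : WalkCertified12 X y e) :
    WalkCertified X y e := by
  rcases h with h | ⟨n₀, hn, hmenu, hpos, hd, hocc, -⟩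
  · exact Or.inl h
  · exact Or.inr ⟨n₀, hn, hmenu, hpos, hd, hocc⟩

/-- **THE INPUT `CapPairCoaxial` (R39e; NOT proved here).**  In a `1`-separated configuration: a ball `e`
carrying a CAP certificate for `(F₁, v₁)` and any walker certificate for `(F₂, v₂)`, with an eleventh contact `y`
off the two closed stars `e + Fᵢ w` (`⟪w, vᵢ⟫ < 0`), has co-axial linear lattices `F₁·Λ₀`, `F₂·Λ₀`.  (The
full/full case is `DoubleStarCoaxialAt`, certified by R39d.) -/
def CapPairCoaxial : Prop :=
  ∀ (F₁ F₂ : EuclideanSpace ℝ (Fin 3) ≃ₗᵢ[ℝ] EuclideanSpace ℝ (Fin 3)), ∀ v₁ ∈ fccSlots, ∀ v₂ ∈ fccSlots,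
    ∀ (X : Finset (EuclideanSpace ℝ (Fin 3))), (∀ p ∈ X, ∀ q ∈ X, p ≠ q → 1 ≤ dist p q) →
    ∀ e ∈ X, ∀ n₀, CapCertified X F₁ e v₁ n₀ → WalkCertified12 X e ⟨F₂, v₂, 0⟩ →
    ∀ y ∈ X, dist e y = 1 →
      (∀ w ∈ fccSlots, ⟪w, v₁⟫_ℝ < 0 → y ≠ e + F₁ w) → (∀ w ∈ fccSlots, ⟪w, v₂⟫_ℝ < 0 → y ≠ e + F₂ w) →
      ∃ (L : EuclideanSpace ℝ (Fin 3) ≃ₗᵢ[ℝ] EuclideanSpace ℝ (Fin 3))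
        (s₁ s₂ : EuclideanSpace ℝ (Fin 3)) (σ σ' : ℤ → ℤ), IsHaggSeq σ ∧ IsHaggSeq σ' ∧
        F₁ '' fccStacking 1 (Real.sqrt (2 / 3)) ⊆ (fun p => L p + s₁) '' barlowStacking 1 (Real.sqrt (2 / 3)) σ ∧
        F₂ '' fccStacking 1 (Real.sqrt (2 / 3)) ⊆ (fun p => L p + s₂) '' barlowStacking 1 (Real.sqrt (2 / 3)) σ'

/-- Co-axiality of linear lattices is symmetric. -/
theorem coaxial_linear_symm {F₁ F₂ : EuclideanSpace ℝ (Fin 3) ≃ₗᵢ[ℝ] EuclideanSpace ℝ (Fin 3)}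
    (h : ∃ (L : EuclideanSpace ℝ (Fin 3) ≃ₗᵢ[ℝ] EuclideanSpace ℝ (Fin 3))
        (s₁ s₂ : EuclideanSpace ℝ (Fin 3)) (σ σ' : ℤ → ℤ), IsHaggSeq σ ∧ IsHaggSeq σ' ∧
        F₁ '' fccStacking 1 (Real.sqrt (2 / 3)) ⊆ (fun p => L p + s₁) '' barlowStacking 1 (Real.sqrt (2 / 3)) σ ∧
        F₂ '' fccStacking 1 (Real.sqrt (2 / 3)) ⊆ (fun p => L p + s₂) '' barlowStacking 1 (Real.sqrt (2 / 3)) σ') :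
    ∃ (L : EuclideanSpace ℝ (Fin 3) ≃ₗᵢ[ℝ] EuclideanSpace ℝ (Fin 3))
      (s₁ s₂ : EuclideanSpace ℝ (Fin 3)) (σ σ' : ℤ → ℤ), IsHaggSeq σ ∧ IsHaggSeq σ' ∧
      F₂ '' fccStacking 1 (Real.sqrt (2 / 3)) ⊆ (fun p => L p + s₁) '' barlowStacking 1 (Real.sqrt (2 / 3)) σ ∧
      F₁ '' fccStacking 1 (Real.sqrt (2 / 3)) ⊆ (fun p => L p + s₂) '' barlowStacking 1 (Real.sqrt (2 / 3)) σ' := by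
  obtain ⟨L, s₁, s₂, σ, σ', hσ, hσ', h₁, h₂⟩ := h
  exact ⟨L, s₂, s₁, σ', σ, hσ', hσ, h₂, h₁⟩

/-- **Pricing one pair of certificates.**  Under `DoubleStarCoaxialAt F₁ F₂` (full/full) and `CapPairCoaxial`
(the other cases): two strong certificates at `e` and an eleventh contact off both stars make the lattices
co-axial. -/
theorem coaxial_of_pair_certified (hX : ∀ p ∈ X, ∀ q ∈ X, p ≠ q → 1 ≤ dist p q)
    {F₁ F₂ : EuclideanSpace ℝ (Fin 3) ≃ₗᵢ[ℝ] EuclideanSpace ℝ (Fin 3)} (hDS : DoubleStarCoaxialAt F₁ F₂)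
    (hCP : CapPairCoaxial) {v₁ v₂ : EuclideanSpace ℝ (Fin 3)} (hv₁ : v₁ ∈ fccSlots) (hv₂ : v₂ ∈ fccSlots)
    {e : EuclideanSpace ℝ (Fin 3)} (he : e ∈ X) (hC₁ : WalkCertified12 X e ⟨F₁, v₁, 0⟩)
    (hC₂ : WalkCertified12 X e ⟨F₂, v₂, 0⟩) {y : EuclideanSpace ℝ (Fin 3)} (hy : y ∈ X) (hd : dist e y = 1)
    (hoff₁ : ∀ w ∈ fccSlots, ⟪w, v₁⟫_ℝ < 0 → y ≠ e + F₁ w) (hoff₂ : ∀ w ∈ fccSlots, ⟪w, v₂⟫_ℝ < 0 → y ≠ e + F₂ w) :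
    ∃ (L : EuclideanSpace ℝ (Fin 3) ≃ₗᵢ[ℝ] EuclideanSpace ℝ (Fin 3))
      (s₁ s₂ : EuclideanSpace ℝ (Fin 3)) (σ σ' : ℤ → ℤ), IsHaggSeq σ ∧ IsHaggSeq σ' ∧
      F₁ '' fccStacking 1 (Real.sqrt (2 / 3)) ⊆ (fun p => L p + s₁) '' barlowStacking 1 (Real.sqrt (2 / 3)) σ ∧
      F₂ '' fccStacking 1 (Real.sqrt (2 / 3)) ⊆ (fun p => L p + s₂) '' barlowStacking 1 (Real.sqrt (2 / 3)) σ' := by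
  rcases hC₁ with ⟨hd₁, hsh₁⟩ | ⟨n₁, hcap₁⟩
  · rcases hC₂ with ⟨hd₂, hsh₂⟩ | ⟨n₂, hcap₂⟩
    · exact hDS v₁ hv₁ v₂ hv₂ X hX e he hd₁ hsh₁ hd₂ hsh₂ y hy hd hoff₁ hoff₂
    · exact coaxial_linear_symm (hCP F₂ F₁ v₂ hv₂ v₁ hv₁ X hX e he n₂ hcap₂ (Or.inl ⟨hd₁, hsh₁⟩) y hy hd hoff₂ hoff₁)
  · exact hCP F₁ F₂ v₁ hv₁ v₂ hv₂ X hX e he n₁ hcap₁ hC₂ y hy hd hoff₁ hoff₂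

/-- **Every state reached by a step carries the strong certificate.** -/
theorem walkStep_certified12 {z : EuclideanSpace ℝ (Fin 3)} {s s' : EuclideanSpace ℝ (Fin 3) × List WalkEntry}
    (hI : WalkInv X z s) (h : walkStep X z s = some s') : ∃ e rest, s'.2 = e :: rest ∧ WalkCertified12 X s'.1 e := by
  classical
  have hrpos : 0 < Real.sqrt (2 / 3) := Real.sqrt_pos.2 (by norm_num)
  obtain ⟨y, stk⟩ := s
  obtain ⟨hyX, hS, e, rest, hstk, -⟩ := hI
  simp only at hyX hS hstk
  subst hstk
  rcases walkStep_cases h with ⟨hfull, hs⟩ | ⟨n, hcap, ⟨e', rest', hr, hn, hs⟩ | ⟨-, hs⟩⟩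
  · refine ⟨e, rest, by rw [hs], Or.inl ⟨?_, fun w hw => ?_⟩⟩
    · rw [hs]; simpa using hyX
    · rw [hs]; simp only [add_sub_cancel_right]; exact hfull w hw
  · -- POP: the predecessor `y` is an exact cap, seen from the resumed frame `G = e′.frame`
    subst hr; subst hn
    obtain ⟨hSo, hLi, hS'⟩ := hS
    obtain ⟨hn, hmenuF, hvn, hle, hgt⟩ := hcap
    have hGF : ∀ x, e'.frame x = e.frame x - (2 * ⟪e.frame x, e.nrm⟫_ℝ) • e.nrm := twin_symm e'.frame e.frame hn hLi.1
    have hmenuG := menu_reflect e.frame e'.frame hn hmenuF hGF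
    have hocc := occupied_nonneg_of_cap e.frame e'.frame hn hle hgt hGF
    have hflip := inner_twin_eq_neg e.frame e'.frame hn hGF
    refine ⟨e', rest', by rw [hs], Or.inr ⟨e.nrm, hn, hmenuG, by rw [hLi.2]; exact hrpos, ?_, fun w hw hw0 => ?_,
      fun w hw hwpos => ?_⟩⟩
    · rw [hs]; simpa using hyX
    · rw [hs]; simp only [add_sub_cancel_right]; exact hocc w hw hw0
    · rw [hs]; simp only [add_sub_cancel_right]
      have hwn : ⟪e'.frame w, e.nrm⟫_ℝ = Real.sqrt (2 / 3) := by
        rcases hmenuG w hw with h' | h' | h'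
        · rw [h'] at hwpos; exact absurd hwpos (lt_irrefl 0)
        · exact h'
        · rw [h'] at hwpos; linarith
      have hwn' : ⟪e.frame w, e.nrm⟫_ℝ = -Real.sqrt (2 / 3) := by have := hflip w; rw [hwn] at this; linarith
      have e1 : y + e'.frame w - (2 * Real.sqrt (2 / 3)) • e.nrm = y + e.frame w := by
        rw [hLi.1 w, hwn]; abel
      rw [e1]
      exact hle w hw (by rw [hwn']; linarith)
  · -- PUSH: the predecessor `y` is an exact cap, seen from the twin frame `F′`
    rw [pushMove_eq] at hs
    obtain ⟨hn, hmenuF, hvn, hle, hgt⟩ := hcap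
    set F' := twinFrame e.frame n with hF'
    have hGF : ∀ x, F' x = e.frame x - (2 * ⟪e.frame x, n⟫_ℝ) • n := fun x => twinFrame_apply e.frame hn x
    have hmenuG := menu_reflect e.frame F' hn hmenuF hGF
    have hocc := occupied_nonneg_of_cap e.frame F' hn hle hgt hGF
    have hflip := inner_twin_eq_neg e.frame F' hn hGF
    have hSne : (fccSlots.filter fun q => 0 < ⟪F' q, n⟫_ℝ).Nonempty := by
      refine ⟨-e.dir, Finset.mem_filter.2 ⟨neg_mem_fccSlots hS.top.1, ?_⟩⟩
      rw [map_neg, inner_neg_left, hflip, hvn, neg_neg]; exact hrpos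
    obtain ⟨hqS, -⟩ := bestCapper_spec F' n z hSne
    obtain ⟨-, hqpos⟩ := Finset.mem_filter.1 hqS
    refine ⟨⟨F', bestCapper F' n z, n⟩, e :: rest, by rw [hs], Or.inr ⟨n, hn, hmenuG, hqpos, ?_, fun w hw hw0 => ?_,
      fun w hw hwpos => ?_⟩⟩
    · rw [hs]; simpa using hyX
    · rw [hs]; simp only [add_sub_cancel_right]; exact hocc w hw hw0
    · rw [hs]; simp only [add_sub_cancel_right]
      have hwn : ⟪F' w, n⟫_ℝ = Real.sqrt (2 / 3) := by
        rcases hmenuG w hw with h' | h' | h'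
        · rw [h'] at hwpos; exact absurd hwpos (lt_irrefl 0)
        · exact h'
        · rw [h'] at hwpos; linarith
      have hwn' : ⟪e.frame w, n⟫_ℝ = -Real.sqrt (2 / 3) := by have := hflip w; rw [hwn] at this; linarith
      have e1 : y + F' w - (2 * Real.sqrt (2 / 3)) • n = y + e.frame w := by
        rw [hGF w, hwn']; module
      rw [e1]
      exact hle w hw (by rw [hwn']; linarith)

/-! ### The bottom of a stack -/

/-- A step does not change the bottom entry. -/
theorem walkStep_getLast? {z : EuclideanSpace ℝ (Fin 3)} {s s' : EuclideanSpace ℝ (Fin 3) × List WalkEntry}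
    (hne : s.2 ≠ []) (h : walkStep X z s = some s') : s'.2.getLast? = s.2.getLast? := by
  obtain ⟨y, stk⟩ := s
  cases stk with
  | nil => exact absurd rfl hne
  | cons e rest =>
    rcases walkStep_cases h with ⟨-, hs⟩ | ⟨n, -, ⟨e', rest', hr, -, hs⟩ | ⟨-, hs⟩⟩
    · rw [hs]
    · subst hr; rw [hs]; exact List.getLast?_cons_cons.symm
    · rw [hs, pushMove_eq]; exact List.getLast?_cons_cons

/-- A run does not change the bottom entry (for runs of states with nonempty stacks, e.g. under `WalkInv`). -/
theorem walkRun_getLast? (hX : ∀ p ∈ X, ∀ q ∈ X, p ≠ q → 1 ≤ dist p q)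
    {s₀ : EuclideanSpace ℝ (Fin 3)} (hs₀ : s₀ ∈ fccSlots)
    (hcert : ExactOnly 0 (fccSlots.filter fun w => 0 < ⟪w, s₀⟫_ℝ))
    {z : EuclideanSpace ℝ (Fin 3)} (hz : ‖z‖ = 1) :
    ∀ (k : ℕ) (s : EuclideanSpace ℝ (Fin 3) × List WalkEntry), WalkInv X z s →
      (walkRun X z k s).2.getLast? = s.2.getLast?
  | 0, s, _ => rfl
  | k + 1, s, hI => by
    cases h : walkStep X z s with
    | none => rw [walkRun_succ_of_none X z k h]
    | some s' =>
      rw [walkRun_succ_of_some X z k h]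
      obtain ⟨hI', -, -⟩ := walkStep_walkInv hX hs₀ hcert hz hI h
      obtain ⟨-, -, e, rest, hstk, -⟩ := hI
      rw [walkRun_getLast? hX hs₀ hcert hz k s' hI', walkStep_getLast? (by rw [hstk]; exact List.cons_ne_nil e rest) h]

/-! ### Co-axial lattices: equal or mirror twins -/

/-- The twin frame undoes itself: `twinFrame (twinFrame G n) n = G` for a unit `n`. -/
theorem twinFrame_twinFrame (G : EuclideanSpace ℝ (Fin 3) ≃ₗᵢ[ℝ] EuclideanSpace ℝ (Fin 3)) {n : EuclideanSpace ℝ (Fin 3)}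
    (hn : ‖n‖ = 1) : twinFrame (twinFrame G n) n = G :=
  LinearIsometryEquiv.ext fun x => by
    rw [twinFrame_apply _ hn, ← twin_symm G (twinFrame G n) hn (fun x => twinFrame_apply G hn x)]

/-- The lattice of a twin frame is the mirror image of the lattice. -/
theorem image_twinFrame_eq (G : EuclideanSpace ℝ (Fin 3) ≃ₗᵢ[ℝ] EuclideanSpace ℝ (Fin 3)) {n : EuclideanSpace ℝ (Fin 3)}
    (hn : ‖n‖ = 1) (S : Set (EuclideanSpace ℝ (Fin 3))) :
    twinFrame G n '' S = (fun x => x - (2 * ⟪x, n⟫_ℝ) • n) '' (G '' S) := by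
  rw [Set.image_image]; exact Set.image_congr fun x _ => twinFrame_apply G hn x

/-- **Co-axial linear fcc lattices are equal or mirror twins across a menu normal of the first.** -/
theorem eq_or_twin_of_coaxial (F₁ F₂ : EuclideanSpace ℝ (Fin 3) ≃ₗᵢ[ℝ] EuclideanSpace ℝ (Fin 3))
    (hco : ∃ (L : EuclideanSpace ℝ (Fin 3) ≃ₗᵢ[ℝ] EuclideanSpace ℝ (Fin 3))
        (s₁ s₂ : EuclideanSpace ℝ (Fin 3)) (σ σ' : ℤ → ℤ), IsHaggSeq σ ∧ IsHaggSeq σ' ∧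
        F₁ '' fccStacking 1 (Real.sqrt (2 / 3)) ⊆ (fun p => L p + s₁) '' barlowStacking 1 (Real.sqrt (2 / 3)) σ ∧
        F₂ '' fccStacking 1 (Real.sqrt (2 / 3)) ⊆ (fun p => L p + s₂) '' barlowStacking 1 (Real.sqrt (2 / 3)) σ') :
    F₁ '' fccStacking 1 (Real.sqrt (2 / 3)) = F₂ '' fccStacking 1 (Real.sqrt (2 / 3)) ∨
    ∃ m : EuclideanSpace ℝ (Fin 3), ‖m‖ = 1 ∧
      (∀ w ∈ fccSlots, ⟪F₁ w, m⟫_ℝ = 0 ∨ ⟪F₁ w, m⟫_ℝ = Real.sqrt (2 / 3) ∨ ⟪F₁ w, m⟫_ℝ = -Real.sqrt (2 / 3)) ∧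
      F₂ '' fccStacking 1 (Real.sqrt (2 / 3)) = twinFrame F₁ m '' fccStacking 1 (Real.sqrt (2 / 3)) := by
  classical
  by_cases hEq : F₁ '' fccStacking 1 (Real.sqrt (2 / 3)) = F₂ '' fccStacking 1 (Real.sqrt (2 / 3))
  · exact Or.inl hEq
  right
  have haff := coaxial_affine_of_linear F₁ F₂ 0 0 hco
  obtain ⟨L, hL⟩ := twin_of_coaxial_of_ne F₁ F₂ 0 0 haff hEq
  set e₃ : EuclideanSpace ℝ (Fin 3) := EuclideanSpace.single (2 : Fin 3) (1 : ℝ) with he₃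
  have he₃n : ‖e₃‖ = 1 := by rw [he₃, PiLp.norm_single, norm_one]
  have hm : ‖L e₃‖ = 1 := by rw [LinearIsometryEquiv.norm_map, he₃n]
  have hinv : ∀ S : Set (EuclideanSpace ℝ (Fin 3)),
      (fun x => x - (2 * ⟪x, L e₃⟫_ℝ) • L e₃) '' ((fun x => x - (2 * ⟪x, L e₃⟫_ℝ) • L e₃) '' S) = S := by
    intro S
    rw [Set.image_image]
    conv_rhs => rw [← Set.image_id S]
    exact Set.image_congr fun x _ => reflect_reflect_unit hm x
  -- in both cases `F₂·Λ₀ = R_{Le₃}(F₁·Λ₀)`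
  have hrel : F₂ '' fccStacking 1 (Real.sqrt (2 / 3)) =
      (fun x => x - (2 * ⟪x, L e₃⟫_ℝ) • L e₃) '' (F₁ '' fccStacking 1 (Real.sqrt (2 / 3))) ∧
      (F₁ '' fccStacking 1 (Real.sqrt (2 / 3)) = L '' fccStacking 1 (Real.sqrt (2 / 3)) ∨
      F₂ '' fccStacking 1 (Real.sqrt (2 / 3)) = L '' fccStacking 1 (Real.sqrt (2 / 3))) := by
    rcases hL with ⟨h₁, h₂⟩ | ⟨h₁, h₂⟩
    · exact ⟨by rw [h₂, image_negConst_eq_reflection_image, ← h₁], Or.inl h₁⟩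
    · exact ⟨by rw [h₁, image_negConst_eq_reflection_image, hinv, h₂], Or.inr h₂⟩
  obtain ⟨hrel, hcase⟩ := hrel
  -- `L e₃` is a menu normal of `L`, hence of `F₁`
  have hLmenu : ∀ w ∈ fccSlots, ⟪L w, L e₃⟫_ℝ = 0 ∨ ⟪L w, L e₃⟫_ℝ = Real.sqrt (2 / 3) ∨
      ⟪L w, L e₃⟫_ℝ = -Real.sqrt (2 / 3) := by
    intro w hw
    rw [LinearIsometryEquiv.inner_map_map, he₃, EuclideanSpace.inner_single_right]
    simpa using slot_apply_two_cases hw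
  have hmenu : ∀ w ∈ fccSlots, ⟪F₁ w, L e₃⟫_ℝ = 0 ∨ ⟪F₁ w, L e₃⟫_ℝ = Real.sqrt (2 / 3) ∨
      ⟪F₁ w, L e₃⟫_ℝ = -Real.sqrt (2 / 3) := by
    rcases hcase with h₁ | h₂
    · exact menu_of_image_eq L F₁ h₁.symm hLmenu
    · -- `F₁·Λ₀ = R(F₂·Λ₀) = R(L·Λ₀)`: the mirror keeps the menu of its own normal
      have h₁ : F₁ '' fccStacking 1 (Real.sqrt (2 / 3)) =
          (fun x => x - (2 * ⟪x, L e₃⟫_ℝ) • L e₃) '' (L '' fccStacking 1 (Real.sqrt (2 / 3))) := by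
        rw [← h₂, hrel, hinv]
      intro w hw
      have hmem : F₁ w ∈ (fun x => x - (2 * ⟪x, L e₃⟫_ℝ) • L e₃) '' (L '' fccStacking 1 (Real.sqrt (2 / 3))) := by
        rw [← h₁]; exact ⟨w, mem_fcc_of_mem_fccSlots hw, rfl⟩
      obtain ⟨x', hx', he⟩ := hmem
      obtain ⟨q, hq, hqx⟩ := hx'
      rw [← hqx] at he
      dsimp only at he
      have hq1 : ‖q‖ = 1 := by
        have := congrArg norm he
        rw [LinearIsometryEquiv.norm_map, norm_eq_one_of_mem_fccSlots hw] at this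
        rw [← this, ← reflection_unit_apply hm, LinearIsometryEquiv.norm_map, LinearIsometryEquiv.norm_map]
      rw [← he, ← reflection_unit_apply hm, inner_reflection_unit hm]
      rcases hLmenu q (mem_fccSlots_of_unit hq hq1) with h | h | h
      · left; rw [h, neg_zero]
      · right; right; rw [h]
      · right; left; rw [h, neg_neg]
  refine ⟨L e₃, hm, hmenu, ?_⟩
  rw [hrel, image_twinFrame_eq F₁ hm]

/-! ### Cross-grain non-co-axiality for non-chain pairs -/

/-- In a mirror-closed family, the twin of a frame whose lattice is in the family has its lattice in the family. -/
theorem family_twin (𝓕 : Set (EuclideanSpace ℝ (Fin 3) ≃ₗᵢ[ℝ] EuclideanSpace ℝ (Fin 3)))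
    (hclosed : ∀ G ∈ 𝓕, ∀ m : EuclideanSpace ℝ (Fin 3), ‖m‖ = 1 →
      (∀ w ∈ fccSlots, ⟪G w, m⟫_ℝ = 0 ∨ ⟪G w, m⟫_ℝ = Real.sqrt (2 / 3) ∨ ⟪G w, m⟫_ℝ = -Real.sqrt (2 / 3)) →
      ∀ G' : EuclideanSpace ℝ (Fin 3) ≃ₗᵢ[ℝ] EuclideanSpace ℝ (Fin 3),
        (∀ x, G' x = G x - (2 * ⟪G x, m⟫_ℝ) • m) → G' ∈ 𝓕)
    {F : EuclideanSpace ℝ (Fin 3) ≃ₗᵢ[ℝ] EuclideanSpace ℝ (Fin 3)}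
    (hF : ∃ G ∈ 𝓕, G '' fccStacking 1 (Real.sqrt (2 / 3)) = F '' fccStacking 1 (Real.sqrt (2 / 3)))
    {m : EuclideanSpace ℝ (Fin 3)} (hm : ‖m‖ = 1)
    (hmenu : ∀ w ∈ fccSlots, ⟪F w, m⟫_ℝ = 0 ∨ ⟪F w, m⟫_ℝ = Real.sqrt (2 / 3) ∨ ⟪F w, m⟫_ℝ = -Real.sqrt (2 / 3)) :
    ∃ G ∈ 𝓕, G '' fccStacking 1 (Real.sqrt (2 / 3)) = twinFrame F m '' fccStacking 1 (Real.sqrt (2 / 3)) := by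
  obtain ⟨G, hG, hGF⟩ := hF
  refine ⟨twinFrame G m, hclosed G hG m hm (menu_of_image_eq F G hGF.symm hmenu) _ (fun x => twinFrame_apply G hm x), ?_⟩
  rw [image_twinFrame_eq G hm, image_twinFrame_eq F hm, hGF]

/-- Descending a sound stack inside a mirror-closed family: if the top lattice is in the family, so is every
level's. -/
theorem family_of_stack (𝓕 : Set (EuclideanSpace ℝ (Fin 3) ≃ₗᵢ[ℝ] EuclideanSpace ℝ (Fin 3)))
    (hclosed : ∀ G ∈ 𝓕, ∀ m : EuclideanSpace ℝ (Fin 3), ‖m‖ = 1 →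
      (∀ w ∈ fccSlots, ⟪G w, m⟫_ℝ = 0 ∨ ⟪G w, m⟫_ℝ = Real.sqrt (2 / 3) ∨ ⟪G w, m⟫_ℝ = -Real.sqrt (2 / 3)) →
      ∀ G' : EuclideanSpace ℝ (Fin 3) ≃ₗᵢ[ℝ] EuclideanSpace ℝ (Fin 3),
        (∀ x, G' x = G x - (2 * ⟪G x, m⟫_ℝ) • m) → G' ∈ 𝓕)
    {z : EuclideanSpace ℝ (Fin 3)} :
    ∀ (e : WalkEntry) (rest : List WalkEntry), StackSound z (e :: rest) →
      (∃ G ∈ 𝓕, G '' fccStacking 1 (Real.sqrt (2 / 3)) = e.frame '' fccStacking 1 (Real.sqrt (2 / 3))) →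
      ∀ e' ∈ e :: rest, ∃ G ∈ 𝓕, G '' fccStacking 1 (Real.sqrt (2 / 3)) = e'.frame '' fccStacking 1 (Real.sqrt (2 / 3))
  | e, [], _, hF, e', he' => by
    rw [List.mem_singleton] at he'; subst he'; exact hF
  | e, e₁ :: rest, hS, hF, e', he' => by
    rcases List.mem_cons.1 he' with rfl | h
    · exact hF
    · obtain ⟨hSo, hLi, hS'⟩ := hS
      obtain ⟨-, hn, hmenu, -, -, -, -⟩ := hSo
      have hfr : e₁.frame = twinFrame e.frame e.nrm := by
        rw [frame_eq_twinFrame_of_link hn hLi, twinFrame_twinFrame _ hn]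
      have hF₁ : ∃ G ∈ 𝓕, G '' fccStacking 1 (Real.sqrt (2 / 3)) = e₁.frame '' fccStacking 1 (Real.sqrt (2 / 3)) := by
        rw [hfr]; exact family_twin 𝓕 hclosed hF hn hmenu
      exact family_of_stack 𝓕 hclosed e₁ rest hS' hF₁ e' h

/-- **Cross-grain non-co-axiality (non-chain pairs).**  `𝓕₁` a mirror-closed family of frames whose lattices
avoid the lattice of `A₂`; `F₁` a frame with lattice in `𝓕₁`; `e₂ :: rest₂` a sound stack whose bottom frame
is `A₂`.  Then the lattices of `F₁` and of `e₂.frame` are NOT co-axial. -/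
theorem not_coaxial_of_family_stack (𝓕₁ : Set (EuclideanSpace ℝ (Fin 3) ≃ₗᵢ[ℝ] EuclideanSpace ℝ (Fin 3)))
    (hclosed : ∀ G ∈ 𝓕₁, ∀ m : EuclideanSpace ℝ (Fin 3), ‖m‖ = 1 →
      (∀ w ∈ fccSlots, ⟪G w, m⟫_ℝ = 0 ∨ ⟪G w, m⟫_ℝ = Real.sqrt (2 / 3) ∨ ⟪G w, m⟫_ℝ = -Real.sqrt (2 / 3)) →
      ∀ G' : EuclideanSpace ℝ (Fin 3) ≃ₗᵢ[ℝ] EuclideanSpace ℝ (Fin 3),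
        (∀ x, G' x = G x - (2 * ⟪G x, m⟫_ℝ) • m) → G' ∈ 𝓕₁)
    {A₂ : EuclideanSpace ℝ (Fin 3) ≃ₗᵢ[ℝ] EuclideanSpace ℝ (Fin 3)}
    (havoid : ∀ G ∈ 𝓕₁, G '' fccStacking 1 (Real.sqrt (2 / 3)) ≠ A₂ '' fccStacking 1 (Real.sqrt (2 / 3)))
    {F₁ : EuclideanSpace ℝ (Fin 3) ≃ₗᵢ[ℝ] EuclideanSpace ℝ (Fin 3)}
    (hF₁ : ∃ G ∈ 𝓕₁, G '' fccStacking 1 (Real.sqrt (2 / 3)) = F₁ '' fccStacking 1 (Real.sqrt (2 / 3)))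
    {z : EuclideanSpace ℝ (Fin 3)} {e₂ : WalkEntry} {rest₂ : List WalkEntry} (hS : StackSound z (e₂ :: rest₂))
    {u₂ n₂ : EuclideanSpace ℝ (Fin 3)} (hbot : (e₂ :: rest₂).getLast? = some ⟨A₂, u₂, n₂⟩) :
    ¬ ∃ (L : EuclideanSpace ℝ (Fin 3) ≃ₗᵢ[ℝ] EuclideanSpace ℝ (Fin 3))
        (s₁ s₂ : EuclideanSpace ℝ (Fin 3)) (σ σ' : ℤ → ℤ), IsHaggSeq σ ∧ IsHaggSeq σ' ∧
        F₁ '' fccStacking 1 (Real.sqrt (2 / 3)) ⊆ (fun p => L p + s₁) '' barlowStacking 1 (Real.sqrt (2 / 3)) σ ∧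
        e₂.frame '' fccStacking 1 (Real.sqrt (2 / 3)) ⊆ (fun p => L p + s₂) '' barlowStacking 1 (Real.sqrt (2 / 3)) σ' := by
  intro hco
  have htop : ∃ G ∈ 𝓕₁, G '' fccStacking 1 (Real.sqrt (2 / 3)) = e₂.frame '' fccStacking 1 (Real.sqrt (2 / 3)) := by
    rcases eq_or_twin_of_coaxial F₁ e₂.frame hco with h | ⟨m, hm, hmenu, h⟩
    · rw [← h]; exact hF₁
    · rw [h]; exact family_twin 𝓕₁ hclosed hF₁ hm hmenu
  obtain ⟨G, hG, hGe⟩ := family_of_stack 𝓕₁ hclosed e₂ rest₂ hS htop ⟨A₂, u₂, n₂⟩ (List.mem_of_getLast? hbot)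
  exact havoid G hG hGe

end Summit.Ventures.Crystal3D.Theorems

end
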